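import Summits.Ventures.YMGap.RobustBall.BoundaryFreeEnergyDim
import Summits.Ventures.YMGap.RobustBall.BoundaryRelativeEntropy
import Summits.Ventures.YMGap.RobustBall.BoundaryFreeEnergyVanHove
import Summits.Ventures.YMGap.RobustBall.WilsonOneStateSymmetry
import HarnessLib

/-!
# Venture YMGap, track ROBUST-BALL — «C-DS-I», ENTROPY FORM: the relative entropy (w.r.t. Haar) of a finite region with an arbitrary boundary
# field is `−b·(energy) − (free energy)` up to a boundary-uniform SURFACE term — `SU(2)` on `ℤ⁴` at EVERY `0 ≤ β_W ≤ 9/25`,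
# and every `SU(N)`, every `d ≥ 2` on the 't Hooft single-link window

HONEST FRAMING. WHAT THIS IS: a venture file (cell `pub-ymgap`, track Y2 ROBUST-BALL / DS, seat ds-3, theorems only, 0 compute): the entropy
cell of «C-DS-I» = the entropy identity `KL(π_Λ^{b,η} ‖ Haar) = −b·γ_Λ^b(S_Λ|η) − log Z_Λ(b|η)` (`BoundaryRelativeEntropy.toReal_klDiv_inner_law_haar_eq`)
∘ the free-energy theorem (`su2_abs_log_normaliser_sub_freeEnergy_le`) ∘ its derivative form (the plaquette-wise boundary estimate
`su2_abs_kernel_plaquette_sub_le` summed over the touching plaquettes, as in `BoundaryFreeEnergyVanHove`). `SU(2)`, `d = 4`,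
tree coupling `0 ≤ b ≤ 9/50`, finite `Λ`, depth data `(φ, m)`, `μ` any DLR state at `b`:
* ★★ `su2_abs_klDiv_inner_law_haar_sub_le` —
  `| KL(π_Λ^{b,η} ‖ Haar_Λ) + b·Σ_{p∈T(Λ)}(2 − μ(Re tr U_p)) + (#T(Λ)/6)·f(b) | ≤ 2b · Σ_{p∈T(Λ)} min 4 (1024√2·exp(−κ₁(R_G(2b))⌊m_p/4⌋))`:
  the ENTROPY of the inner configuration relative to Haar, for ANY boundary field, equals the extensive quantity
  `−b·(infinite-volume mean energy of the touching plaquettes) − (#T/6)·f(b)` up to a boundary-uniform surface term — so the specific entropy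
  of a cube with arbitrary boundary conditions converges, uniformly in the boundary field, to the infinite-volume entropy density
  `−b·(2 − μ(Re tr U_p)) − f(b)/6` per plaquette.
* ★★★ `su2_abs_klDiv_inner_law_haar_div_sub_le_of_depth` — VAN HOVE FORM, ARBITRARY SHAPES: with `u(b) = μ(Re tr U_{p₀})` the mean plaquette
  of THE DLR state (unique and axis-symmetric on the window, `WilsonOneStateSymmetry.su2_wilson_oneState_symmetric`) and a depth budget `K`,
  `|KL(π_Λ^{b,η} ‖ Haar_Λ)/#T(Λ) − (−b(2 − u(b)) − f(b)/6)| ≤ 2b·(1024√2·exp(−κ₁(R_G(2b))·K) + 4·#{p ∈ T(Λ) : m_p < 4K}/#T(Λ))` — the specific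
  relative entropy of ANY finite region with ANY boundary field is within an explicit surface/volume error of the infinite-volume density.
* ★★ `suN_abs_klDiv_inner_law_haar_sub_le_dim` — the same for EVERY `N ≥ 2` and EVERY `d ≥ 2` on the 't Hooft single-link window
  `0 ≤ β ≤ 1/(12(d−1))`, `β < 1/(8d)` (tree coupling `Nβ`, ratio `max(ρ,½)`, `6(d−1)β/(½ − 2(d−1)β) ≤ ρ < 1`), HYPOTHESIS-FREE:
  `|KL(π_Λ^{Nβ,η} ‖ Haar_Λ) + Nβ·Σ_{p∈T(Λ)}(N − μ(Re tr U_p)) + (#T(Λ)/#planes(d))·f(Nβ)| ≤ 2Nβ·Σ_{p∈T(Λ)} min (2N) (32N⁴√N·max(ρ,½)^{⌊D_p⌋})`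
  (from `BoundaryFreeEnergyDim.suN_abs_log_normaliser_sub_freeEnergy_le` and `suN_abs_kernel_plaquette_sub_le`).
WHAT THIS IS NOT: lattice strong coupling; nothing about the continuum limit or Clay. Everything here is proved. [folklore]
-/

noncomputable section

open MeasureTheory ProbabilityTheory InformationTheory Real Finset Set
open scoped NNReal
open Literature.Probability.LatticeModels hiding configShift configShift_apply
open Literature.MathematicalPhysics.QuantumLattice
open Literature.MathematicalPhysics.QuantumFieldTheory (haarProbability)
open Summit.Ventures.YMGap.StarWindowGauge (gaugeR gaugeR_lt_one_of_le)
open Summit.Ventures.YMGap.StarLemmaG (gaugeR_nonneg)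

namespace Summit.Ventures.YMGap.RobustBall

namespace BoundaryFreeEnergy

/-- ★★ **«C-DS-I», ENTROPY FORM** (`SU(2)`, `d = 4`, tree coupling `0 ≤ b ≤ 9/50`; finite `Λ`, boundary field `η`, DLR state `μ` at `b`, depth
profile `φ` of `Λ` and depths `m_p ≤ φ` on the links of the plaquettes touching `Λ`):
`|KL(π_Λ^{b,η} ‖ Haar_Λ) + b·Σ_{p∈T(Λ)}(2 − μ(Re tr U_p)) + (#T(Λ)/6)·f(b)| ≤ 2b·Σ_{p∈T(Λ)} min 4 (1024√2·exp(−κ₁(R_G(2b))⌊m_p/4⌋))`. [folklore] -/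
theorem su2_abs_klDiv_inner_law_haar_sub_le {b : ℝ} (hb0 : 0 ≤ b) (hb : b ≤ 9 / 50)
    {μ : Measure (LGConfig 4 (SUN 2))} (hμ : μ ∈ ymGibbsMeasures (d := 4) (fundamentalRep (Fin 2)) b)
    (Λ : Finset (ZdEdge 4)) (η : LGConfig 4 (SUN 2)) (φ : ZdEdge 4 → ℝ)
    (hφ : ∀ x y : ZdEdge 4, φ x ≤ φ y + ‖x.1 - y.1‖) (hφΛ : ∀ x, 0 < φ x → x ∈ Λ)
    (m : ZdPlaquette 4 → ℝ) (hm : ∀ p ∈ plaquettesTouching Λ, ∀ x ∈ plaquetteEdges p, m p ≤ φ x) :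
    |(klDiv ((Measure.pi fun _ : ↥Λ => haarProbability (SUN 2)).tilted
          (fun ζ => -b * wilsonBoundaryAction (fundamentalRep (Fin 2)) Λ (glueWith Λ ζ η)))
        (Measure.pi fun _ : ↥Λ => haarProbability (SUN 2))).toReal +
        b * ∑ p ∈ plaquettesTouching Λ, ((2 : ℝ) - ∫ U, plaquetteObs (fundamentalRep (Fin 2)) p.1 p.2.1.1 p.2.1.2 U ∂μ) +
        (plaquettesTouching Λ).card / 6 * freeEnergyDensity 4 (fundamentalRep (Fin 2)) b| ≤
      2 * b * ∑ p ∈ plaquettesTouching Λ,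
        min 4 (1024 * Real.sqrt 2 * Real.exp (-(starRate 4 (gaugeR (2 * b)) * ⌊m p / (4 : ℕ)⌋₊))) := by
  have hρc : Continuous (fundamentalRep (Fin 2)) := continuous_fundamentalRep (Fin 2)
  rw [toReal_klDiv_inner_law_haar_eq (fundamentalRep (Fin 2)) hρc b Λ η]
  have h1 := su2_abs_log_normaliser_sub_freeEnergy_le hb0 hb Λ η φ hφ hφΛ m hm
  -- the derivative form of «C-DS-I»: kernel energy = Σ (2 − γ(W_p)), each plaquette within the boundary error of μ(W_p)
  have h2 : |(∫ U, wilsonBoundaryAction (fundamentalRep (Fin 2)) Λ U ∂(ymSpecification (d := 4) (fundamentalRep (Fin 2)) b Λ η)) -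
      ∑ p ∈ plaquettesTouching Λ, ((2 : ℝ) - ∫ U, plaquetteObs (fundamentalRep (Fin 2)) p.1 p.2.1.1 p.2.1.2 U ∂μ)| ≤
      ∑ p ∈ plaquettesTouching Λ,
        min 4 (1024 * Real.sqrt 2 * Real.exp (-(starRate 4 (gaugeR (2 * b)) * ⌊m p / (4 : ℕ)⌋₊))) := by
    rw [su2_integral_wilsonBoundaryAction_kernel, ← Finset.sum_sub_distrib]
    refine (Finset.abs_sum_le_sum_abs _ _).trans (Finset.sum_le_sum fun p hp => ?_)
    rw [show ∀ x y : ℝ, ((2 : ℝ) - x) - (2 - y) = -(x - y) from fun x y => by ring, abs_neg]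
    exact su2_abs_kernel_plaquette_sub_le hb0 le_rfl hb hμ Λ η φ hφ hφΛ p (hm p hp)
  rw [abs_le] at h1 h2 ⊢
  set S := ∑ p ∈ plaquettesTouching Λ,
    min 4 (1024 * Real.sqrt 2 * Real.exp (-(starRate 4 (gaugeR (2 * b)) * ⌊m p / (4 : ℕ)⌋₊))) with hS
  set E := ∫ U, wilsonBoundaryAction (fundamentalRep (Fin 2)) Λ U ∂(ymSpecification (d := 4) (fundamentalRep (Fin 2)) b Λ η) with hE
  set A := ∑ p ∈ plaquettesTouching Λ, ((2 : ℝ) - ∫ U, plaquetteObs (fundamentalRep (Fin 2)) p.1 p.2.1.1 p.2.1.2 U ∂μ) with hA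
  -- `|E − A| ≤ S`, `|log Z − (#T/6) f| ≤ b S`; `−bE − log Z + bA + (#T/6)f = −b(E − A) − (log Z − (#T/6)f)`
  have hbE : |b * (E - A)| ≤ b * S := by rw [abs_mul, abs_of_nonneg hb0]; exact mul_le_mul_of_nonneg_left (abs_le.2 h2) hb0
  rw [abs_le] at hbE
  constructor <;> nlinarith [hbE.1, hbE.2, h1.1, h1.2]

/-- ★★★ **THE SPECIFIC ENTROPY OF A FINITE REGION WITH AN ARBITRARY BOUNDARY FIELD CONVERGES, UNIFORMLY IN THE BOUNDARY FIELD, TO THE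
INFINITE-VOLUME ENTROPY DENSITY — VAN HOVE FORM, ARBITRARY SHAPES** (`SU(2)`, `d = 4`, tree coupling `0 ≤ b ≤ 9/50`; `μ` THE DLR state at
`b` (unique and axis-symmetric there, so all plaquette means equal `u(b) = μ(Re tr U_{p₀})`, `p₀ = (0; 0,1)`); finite `Λ` with `T(Λ) ≠ ∅`, boundary
field `η`, depth data `(φ, m)`, depth budget `K`):
`|KL(π_Λ^{b,η} ‖ Haar_Λ)/#T(Λ) − (−b·(2 − u(b)) − f(b)/6)| ≤ 2b·(1024√2·exp(−κ₁(R_G(2b))·K) + 4·#{p ∈ T(Λ) : m_p < 4K}/#T(Λ))` —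
for cubes of side `M` with `K ≍ √M` the right side is `O(e^{−κ√M} + 1/√M) → 0` with ONE rate for all boundary fields; `−b(2 − u) − f/6` is the
relative entropy density of the infinite-volume state w.r.t. Haar (minus its specific entropy). [folklore] -/
theorem su2_abs_klDiv_inner_law_haar_div_sub_le_of_depth {b : ℝ} (hb0 : 0 ≤ b) (hb : b ≤ 9 / 50)
    {μ : Measure (LGConfig 4 (SUN 2))} (hμ : μ ∈ ymGibbsMeasures (d := 4) (fundamentalRep (Fin 2)) b)
    (Λ : Finset (ZdEdge 4)) (hT : (plaquettesTouching Λ).Nonempty) (η : LGConfig 4 (SUN 2)) (φ : ZdEdge 4 → ℝ)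
    (hφ : ∀ x y : ZdEdge 4, φ x ≤ φ y + ‖x.1 - y.1‖) (hφΛ : ∀ x, 0 < φ x → x ∈ Λ)
    (m : ZdPlaquette 4 → ℝ) (hm : ∀ p ∈ plaquettesTouching Λ, ∀ x ∈ plaquetteEdges p, m p ≤ φ x) (K : ℕ) :
    |(klDiv ((Measure.pi fun _ : ↥Λ => haarProbability (SUN 2)).tilted
          (fun ζ => -b * wilsonBoundaryAction (fundamentalRep (Fin 2)) Λ (glueWith Λ ζ η)))
        (Measure.pi fun _ : ↥Λ => haarProbability (SUN 2))).toReal / (plaquettesTouching Λ).card -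
        (-b * ((2 : ℝ) - ∫ U, plaquetteObs (fundamentalRep (Fin 2)) 0 0 1 U ∂μ) - freeEnergyDensity 4 (fundamentalRep (Fin 2)) b / 6)| ≤
      2 * b * (1024 * Real.sqrt 2 * Real.exp (-(starRate 4 (gaugeR (2 * b)) * K)) +
        4 * ((plaquettesTouching Λ).filter fun p => m p < 4 * K).card / (plaquettesTouching Λ).card) := by
  classical
  have hρc : Continuous (fundamentalRep (Fin 2)) := continuous_fundamentalRep (Fin 2)
  set T := plaquettesTouching Λ with hTdef
  set κ : ℝ := starRate 4 (gaugeR (2 * b)) with hκ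
  set C : ℝ := 1024 * Real.sqrt 2 with hC
  have hC0 : 0 ≤ C := by positivity
  have hκ0 : 0 ≤ κ := (starRate_pos (gaugeR_nonneg (by linarith) (by linarith)) (gaugeR_lt_one_of_le (by linarith) (by linarith))).le
  have hTpos : (0 : ℝ) < (T.card : ℝ) := by exact_mod_cast Finset.card_pos.2 hT
  -- the one state is axis symmetric: all plaquette means agree
  obtain ⟨ν, h1, h2, -, -⟩ := su2_wilson_oneState_symmetric (b := b) (abs_le.2 ⟨by linarith, hb⟩)
  have hμν : μ = ν := by rw [h1] at hμ; exact Set.mem_singleton_iff.1 hμ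
  have hνL : ν ∈ infiniteVolumeLimitPoints (d := 4) (fundamentalRep (Fin 2)) b := by rw [h2]; exact Set.mem_singleton _
  have hplane : ∀ p ∈ T, ∫ U, plaquetteObs (fundamentalRep (Fin 2)) p.1 p.2.1.1 p.2.1.2 U ∂μ =
      ∫ U, plaquetteObs (fundamentalRep (Fin 2)) 0 0 1 U ∂μ := fun p _ => by
    rw [hμν]; exact PlaquettePositivity.integral_plaquetteObs_eq (fundamentalRep (Fin 2)) hρc (by norm_num) hνL p.1 (ne_of_lt p.2.2)
  have hsum : ∑ p ∈ T, ((2 : ℝ) - ∫ U, plaquetteObs (fundamentalRep (Fin 2)) p.1 p.2.1.1 p.2.1.2 U ∂μ) =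
      (T.card : ℝ) * ((2 : ℝ) - ∫ U, plaquetteObs (fundamentalRep (Fin 2)) 0 0 1 U ∂μ) := by
    rw [Finset.sum_congr rfl fun p hp => by rw [hplane p hp], Finset.sum_const, nsmul_eq_mul]
  have hmain := su2_abs_klDiv_inner_law_haar_sub_le hb0 hb hμ Λ η φ hφ hφΛ m hm
  rw [hsum] at hmain
  have hS := surface_sum_le_of_depth hκ0 hC0 T m K
  set kl := (klDiv ((Measure.pi fun _ : ↥Λ => haarProbability (SUN 2)).tilted
      (fun ζ => -b * wilsonBoundaryAction (fundamentalRep (Fin 2)) Λ (glueWith Λ ζ η)))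
    (Measure.pi fun _ : ↥Λ => haarProbability (SUN 2))).toReal with hkl
  set u := ∫ U, plaquetteObs (fundamentalRep (Fin 2)) 0 0 1 U ∂μ with hu
  set f := freeEnergyDensity 4 (fundamentalRep (Fin 2)) b with hf
  rw [show kl / (T.card : ℝ) - (-b * (2 - u) - f / 6) = (kl + b * ((T.card : ℝ) * (2 - u)) + (T.card : ℝ) / 6 * f) / (T.card : ℝ) by
      field_simp; ring, abs_div, abs_of_pos hTpos, div_le_iff₀ hTpos]
  refine hmain.trans ?_
  have e : 2 * b * (C * Real.exp (-(κ * K)) + 4 * ((T.filter fun p => m p < 4 * K).card : ℝ) / T.card) * T.card =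
      2 * b * (C * Real.exp (-(κ * K)) * T.card + 4 * (T.filter fun p => m p < 4 * K).card) := by
    field_simp
  rw [e]
  exact mul_le_mul_of_nonneg_left hS (by linarith)

/-- ★★ **«C-DS-I», ENTROPY FORM, EVERY `N ≥ 2` AND EVERY `d ≥ 2`** (Wilson action, 't Hooft `0 ≤ β ≤ 1/(12(d−1))`, `β < 1/(8d)`, tree
coupling `Nβ`, ratio `max(ρ,½)` with `6(d−1)β/(½ − 2(d−1)β) ≤ ρ < 1`; finite `Λ`, boundary field `η`, DLR state `μ` at `Nβ`, depths `D_p` with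
`D_p ≤ ‖y − z‖_∞` for every link `y` of `p` and every link `z ∉ Λ`):
`|KL(π_Λ^{Nβ,η} ‖ Haar_Λ) + Nβ·Σ_{p∈T(Λ)}(N − μ(Re tr U_p)) + (#T(Λ)/#planes(d))·f(Nβ)| ≤ 2Nβ·Σ_{p∈T(Λ)} min (2N) (32N⁴√N·max(ρ,½)^{⌊D_p⌋})` —
HYPOTHESIS-FREE. [folklore] -/
theorem suN_abs_klDiv_inner_law_haar_sub_le_dim {d N : ℕ} (hd : 2 ≤ d) (hN : 2 ≤ N) {β ρ : ℝ} (hβ0 : 0 ≤ β)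
    (hβ : β ≤ 1 / (12 * ((d : ℝ) - 1))) (hβ' : β < 1 / (8 * (d : ℝ)))
    (hρ : 6 * ((d : ℝ) - 1) * β / (1 / 2 - β * (2 * ((d : ℝ) - 1))) ≤ ρ) (hρ1 : ρ < 1) [DecidableEq (ZdEdge d)]
    {μ : Measure (LGConfig d (SUN N))} (hμ : μ ∈ ymGibbsMeasures (d := d) (fundamentalRep (Fin N)) (N * β))
    (Λ : Finset (ZdEdge d)) (η : LGConfig d (SUN N)) (D : ZdPlaquette d → ℝ)
    (hD : ∀ p ∈ plaquettesTouching Λ, ∀ y ∈ plaquetteEdges p, ∀ z, z ∉ Λ → D p ≤ ‖y.1 - z.1‖) :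
    |(klDiv ((Measure.pi fun _ : ↥Λ => haarProbability (SUN N)).tilted
          (fun ζ => -(N * β) * wilsonBoundaryAction (fundamentalRep (Fin N)) Λ (glueWith Λ ζ η)))
        (Measure.pi fun _ : ↥Λ => haarProbability (SUN N))).toReal +
        N * β * ∑ p ∈ plaquettesTouching Λ, ((N : ℝ) - ∫ U, plaquetteObs (fundamentalRep (Fin N)) p.1 p.2.1.1 p.2.1.2 U ∂μ) +
        (plaquettesTouching Λ).card / (Fintype.card {q : Fin d × Fin d // q.1 < q.2} : ℝ) *
          freeEnergyDensity d (fundamentalRep (Fin N)) (N * β)| ≤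
      2 * (N * β) * ∑ p ∈ plaquettesTouching Λ,
        min (2 * (N : ℝ)) (32 * (N : ℝ) ^ 4 * Real.sqrt N * (max ρ (1 / 2)) ^ ⌊D p⌋₊) := by
  haveI : SecondCountableTopology (Matrix.specialUnitaryGroup (Fin N) ℂ) :=
    haveI : SecondCountableTopology (Matrix (Fin N) (Fin N) ℂ) := inferInstanceAs (SecondCountableTopology (Fin N → Fin N → ℂ))
    Topology.IsEmbedding.subtypeVal.secondCountableTopology
  have hρc : Continuous (fundamentalRep (Fin N)) := continuous_fundamentalRep (Fin N)
  have hNβ0 : 0 ≤ (N : ℝ) * β := by positivity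
  have hd2 : (2 : ℝ) ≤ d := by exact_mod_cast hd
  -- the 't Hooft window sits inside the single-link door `2(d−1)|β| < 1/2`
  have hb : |β| * (2 * ((d : ℝ) - 1)) < 1 / 2 := by
    rw [abs_of_nonneg hβ0]
    have h1 : β * (12 * ((d : ℝ) - 1)) ≤ 1 := by rwa [le_div_iff₀ (by nlinarith)] at hβ
    nlinarith
  have hρ' : 6 * ((d : ℝ) - 1) * |β| / (1 / 2 - |β| * (2 * ((d : ℝ) - 1))) ≤ ρ := by rwa [abs_of_nonneg hβ0]
  rw [toReal_klDiv_inner_law_haar_eq (fundamentalRep (Fin N)) hρc (N * β) Λ η]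
  have h1 := suN_abs_log_normaliser_sub_freeEnergy_le hd hN hβ0 hβ hβ' hρ hρ1 Λ η D hD
  -- the derivative form of «C-DS-I», every `N`: kernel energy = Σ (N − γ(W_p)), each plaquette within the boundary error of μ(W_p)
  have h2 : |(∫ U, wilsonBoundaryAction (fundamentalRep (Fin N)) Λ U ∂(ymSpecification (d := d) (fundamentalRep (Fin N)) (N * β) Λ η)) -
      ∑ p ∈ plaquettesTouching Λ, ((N : ℝ) - ∫ U, plaquetteObs (fundamentalRep (Fin N)) p.1 p.2.1.1 p.2.1.2 U ∂μ)| ≤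
      ∑ p ∈ plaquettesTouching Λ, min (2 * (N : ℝ)) (32 * (N : ℝ) ^ 4 * Real.sqrt N * (max ρ (1 / 2)) ^ ⌊D p⌋₊) := by
    rw [suN_integral_wilsonBoundaryAction_kernel, ← Finset.sum_sub_distrib]
    refine (Finset.abs_sum_le_sum_abs _ _).trans (Finset.sum_le_sum fun p hp => ?_)
    rw [show ∀ x y : ℝ, ((N : ℝ) - x) - (N - y) = -(x - y) from fun x y => by ring, abs_neg]
    exact suN_abs_kernel_plaquette_sub_le (by omega) hN hb hρ' hρ1 hμ Λ η p (hD p hp)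
  rw [abs_le] at h1 h2 ⊢
  set S := ∑ p ∈ plaquettesTouching Λ, min (2 * (N : ℝ)) (32 * (N : ℝ) ^ 4 * Real.sqrt N * (max ρ (1 / 2)) ^ ⌊D p⌋₊) with hS
  set E := ∫ U, wilsonBoundaryAction (fundamentalRep (Fin N)) Λ U ∂(ymSpecification (d := d) (fundamentalRep (Fin N)) (N * β) Λ η) with hE
  set A := ∑ p ∈ plaquettesTouching Λ, ((N : ℝ) - ∫ U, plaquetteObs (fundamentalRep (Fin N)) p.1 p.2.1.1 p.2.1.2 U ∂μ) with hA
  have hbE : |N * β * (E - A)| ≤ N * β * S := by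
    rw [abs_mul, abs_of_nonneg hNβ0]; exact mul_le_mul_of_nonneg_left (abs_le.2 h2) hNβ0
  rw [abs_le] at hbE
  constructor <;> nlinarith [hbE.1, hbE.2, h1.1, h1.2]

end BoundaryFreeEnergy

end Summit.Ventures.YMGap.RobustBall

end
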